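import Summits.QuantumFields.YangMills.Theorems.VirialFluxGapLeftChartLinearisation
import HarnessLib

/-!
# Sign-class bookkeeping and the chordal distance bound for ring histories
# (layer (B2/B3) of the DIRECT Laplace road to ⟨stmt-QuantumFields-24204⟩ `VirialFluxGap.SharpTwistedLaplace`; prelude of `…RingSliceFreeTransversality`)

Helper module (free-hands work of width seat ym-line-sfw-p2-w3 g56, cell ym-idea-1; `--supports 24204`).  Small lemmas used by the slice-free
transversality theorem ✓`exists_skew_linearised_le_sqrt_ringDeficit`:
* sign classes `s : Fin 3 → Bool` of twist-eater reference rings (`w_s(k) = centreElem(s_k)·(N₀ if z_k else 1)`): `−1 ≠ 1`, `centreElem` is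
  injective, `centreElem(¬b) = (−1)·centreElem(b)`, the FLIPPED class has wraps `centreElem(z_k)·w_s(k)` (`signClass_flip_wraps`), and two classes
  that are neither equal nor flips of each other have different invariants (`signClass_invariants_ne`: an untwisted wrap or a product of two
  twisted wraps differs — the hypothesis `hne` of ✓`ringDist_ge_of_invariants_ne`);
* ★ `ringDist_le_of_fd_le`: per-variable Frobenius closeness `fd ≤ τ` on the `6L⁴ + L³ ≤ 7L⁴` variables gives chordal ring distance
  `≤ (7/2)L⁴τ²`; `chart_sq_sum_le`: `Σ‖A‖² + Σ‖B‖² ≤ 7L⁴m²`; `conj_combFlat_apply`; the far-class arithmetic `far_class_aux`, `far_class_aux'`.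

Everything here is PROVED; no definitions, no named facts (namespace `Summit.QuantumFields.YangMills.Theorems.VirialFluxGap.ChartPhase`).
HONEST FRAMING: bookkeeping; ⟨24204⟩, ⟨24319⟩ and every rung stay OPEN; the Yang–Mills mass gap (Clay) is NOT touched; no summit is proved by a line.

## References
* M. Lüscher, Nucl. Phys. B219 (1983), §2. [Luscher1983]
* A. González-Arroyo, C. P. Korthals Altes, Nucl. Phys. B311 (1988), §2. [GonzalezarroyoAltes1988]
-/

set_option autoImplicit false

noncomputable section

open scoped Matrix Matrix.Norms.Frobenius BigOperators
open NormedSpace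
open Literature.MathematicalPhysics.QuantumFieldTheory hiding SU2
open Literature.MathematicalPhysics.QuantumLattice
open Summit.QuantumFields.YangMills.Theorems.FemtoTransferGap
open Summit.QuantumFields.YangMills.Theorems.FemtoTransferGap.TT
open Summit.QuantumFields.YangMills.Theorems.FemtoTransferGap.TwoLattice
open Summit.QuantumFields.YangMills.Theorems.FemtoTransferGap.TwoLattice.Flat
open Summit.QuantumFields.YangMills.Theorems.FemtoTransferGap.TwoLattice.Cov
open Summit.QuantumFields.YangMills.Theorems.ToronValleyVolume.Lojasiewicz
open Summit.QuantumFields.YangMills.Theorems.TwistEaterVolume.Quadratic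
open Summit.QuantumFields.YangMills.Theorems.VirialFluxGap.RingDeficit
open Summit.QuantumFields.YangMills.Theorems.ColdBoxAllGroups (norm_exp_sub_one_sub_le norm_exp_sub_one_le')

namespace Summit.QuantumFields.YangMills.Theorems.VirialFluxGap.ChartPhase

variable {L : ℕ} [NeZero L]

/-! ## §1 Sign classes, chordal distance from per-variable closeness, arithmetic -/

/-- `−1 ≠ 1` in `SU(2)`. [folklore] -/
theorem negOne_ne_one : (negOne : SU2) ≠ 1 := by
  intro h
  have h1 := congrArg su2Quat h
  rw [su2Quat_negOne, su2Quat_one] at h1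
  have h2 := congrArg QuaternionAlgebra.re h1
  rw [Quaternion.re_neg, Quaternion.re_one] at h2
  norm_num at h2

/-- `centreElem` is injective. [folklore] -/
theorem centreElem_injective' {b b' : Bool} (h : centreElem b = centreElem b') : b = b' := by
  cases b <;> cases b'
  · rfl
  · rw [centreElem_false, centreElem_true] at h; exact absurd h.symm negOne_ne_one
  · rw [centreElem_false, centreElem_true] at h; exact absurd h negOne_ne_one
  · rfl

/-- `centreElem (!b) = (−1)·centreElem b`. [folklore] -/
theorem centreElem_not_eq (b : Bool) : centreElem (!b) = negOne * centreElem b := by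
  cases b
  · rw [Bool.not_false, centreElem_true, centreElem_false, mul_one]
  · rw [Bool.not_true, centreElem_false, centreElem_true, ← centreElem_true, centreElem_mul_self]

/-- The FLIPPED sign class (flip exactly the twisted signs) has wraps `centreElem(z_k)·w_s(k)`. [folklore] -/
theorem signClass_flip_wraps {z s s' : Fin 3 → Bool} (hu : ∀ k, z k = false → s' k = s k) (ht : ∀ k, z k = true → s' k ≠ s k)
    (X : Fin 3 → SU2) (k : Fin 3) :
    centreElem (s' k) * X k = centreElem (z k) * (centreElem (s k) * X k) := by
  cases hk : z k
  · rw [hu k hk, centreElem_false, one_mul]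
  · have h1 : s' k = !s k := by
      have := ht k hk
      cases hs : s k <;> cases hs' : s' k <;> simp_all
    rw [h1, centreElem_not_eq, centreElem_true, mul_assoc]

/-- Two sign classes that are neither equal nor flips of each other have different invariants (an untwisted wrap, or a product of two
twisted wraps). [folklore] -/
theorem signClass_invariants_ne {z s s' : Fin 3 → Bool} {N₀ : SU2} (hi : ¬ ∀ k, s' k = s k)
    (hii : ¬ ((∀ k, z k = false → s' k = s k) ∧ (∀ k, z k = true → s' k ≠ s k))) :
    (∃ k, z k = false ∧ (centreElem (s k) * (if z k then N₀ else 1)) ≠ (centreElem (s' k) * (if z k then N₀ else 1))) ∨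
      (∃ k₁ k₂, z k₁ = true ∧ z k₂ = true ∧
        (centreElem (s k₁) * (if z k₁ then N₀ else 1)) * (centreElem (s k₂) * (if z k₂ then N₀ else 1)) ≠
          (centreElem (s' k₁) * (if z k₁ then N₀ else 1)) * (centreElem (s' k₂) * (if z k₂ then N₀ else 1))) := by
  by_cases hu : ∀ k, z k = false → s' k = s k
  · right
    obtain ⟨k₁, hk₁⟩ : ∃ k, s' k ≠ s k := by
      by_contra hcon; push Not at hcon; exact hi hcon
    have hz₁ : z k₁ = true := by
      cases hzk : z k₁
      · exact absurd (hu k₁ hzk) hk₁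
      · rfl
    obtain ⟨k₂, hz₂, hk₂⟩ : ∃ k, z k = true ∧ s' k = s k := by
      by_contra hcon; push Not at hcon; exact hii ⟨hu, fun k hk => hcon k hk⟩
    refine ⟨k₁, k₂, hz₁, hz₂, ?_⟩
    have h1 : s' k₁ = !s k₁ := by
      cases hs : s k₁ <;> cases hs' : s' k₁ <;> simp_all
    rw [hk₂, h1, centreElem_not_eq, if_pos hz₁, if_pos hz₂]
    intro hcon
    have hc := negOne_mem_center
    have e : negOne * centreElem (s k₁) * N₀ * (centreElem (s k₂) * N₀) = negOne * (centreElem (s k₁) * N₀ * (centreElem (s k₂) * N₀)) := by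
      simp only [mul_assoc]
    rw [e] at hcon
    have : (1 : SU2) * (centreElem (s k₁) * N₀ * (centreElem (s k₂) * N₀)) = negOne * (centreElem (s k₁) * N₀ * (centreElem (s k₂) * N₀)) := by
      rw [one_mul]; exact hcon
    exact negOne_ne_one (mul_right_cancel this).symm
  · left
    push Not at hu
    obtain ⟨k, hzk, hk⟩ := hu
    refine ⟨k, hzk, ?_⟩
    rw [if_neg (by simp [hzk]), mul_one, mul_one]
    exact fun hcon => hk (centreElem_injective' hcon).symm

/-- ★ **Chordal distance from per-variable closeness**: per-variable `fd ≤ τ` gives `ringDist ≤ (7/2)·L⁴·τ²` (`6L⁴ + L³ ≤ 7L⁴` variables,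
`½fd²` each). [folklore] -/
theorem ringDist_le_of_fd_le {X Y : (Fin (2 * L - 1 + 1) → GaugeConfig 3 L SU2) × (Site 3 L → SU2)} {τ : ℝ} (hτ : 0 ≤ τ)
    (h1 : ∀ i e, fd (X.1 i e) (Y.1 i e) ≤ τ) (h2 : ∀ x, fd (X.2 x) (Y.2 x) ≤ τ) :
    (∑ i, (6 * (L : ℝ) ^ 3 - timeCoupling su2Rep (X.1 i) (Y.1 i))) + ∑ x, (2 - ((su2Rep (X.2 x * (Y.2 x)⁻¹)).trace).re) ≤
      7 / 2 * (L : ℝ) ^ 4 * τ ^ 2 := by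
  have hL1 : (1 : ℝ) ≤ (L : ℝ) := by exact_mod_cast NeZero.one_le
  have hcardE : (Fintype.card (Edge 3 L) : ℝ) = 3 * (L : ℝ) ^ 3 := by
    simp only [Edge, Site, Fintype.card_prod, Fintype.card_pi, Finset.prod_const, Finset.card_univ, Fintype.card_fin, ZMod.card]
    push_cast; ring
  have hcardS : (Fintype.card (Site 3 L) : ℝ) = (L : ℝ) ^ 3 := by
    simp only [Site, Fintype.card_pi, Finset.prod_const, Finset.card_univ, Fintype.card_fin, ZMod.card]
    push_cast; ring
  have hcardI : (Fintype.card (Fin (2 * L - 1 + 1)) : ℝ) = 2 * (L : ℝ) := by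
    have hL' : 2 * L - 1 + 1 = 2 * L := by have := NeZero.one_le (n := L); omega
    rw [Fintype.card_fin, hL']; push_cast; ring
  have hfd0 : ∀ U V : SU2, 0 ≤ fd U V := fun U V => by unfold fd; rw [frobNorm_eq_norm]; exact norm_nonneg _
  have hslice : ∀ i, 6 * (L : ℝ) ^ 3 - timeCoupling su2Rep (X.1 i) (Y.1 i) ≤ 3 * (L : ℝ) ^ 3 * ((2 : ℝ)⁻¹ * τ ^ 2) := by
    intro i
    rw [timeCoupling_deficit_eq_half_sum_fd_sq, ← hcardE]
    have h := Finset.sum_le_card_nsmul (Finset.univ : Finset (Edge 3 L)) (fun e => (2 : ℝ)⁻¹ * fd (X.1 i e) (Y.1 i e) ^ 2)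
      ((2 : ℝ)⁻¹ * τ ^ 2) (fun e _ => by
        have := h1 i e
        nlinarith [mul_le_mul this this (hfd0 _ _) hτ])
    rw [Finset.card_univ, nsmul_eq_mul] at h
    exact h
  have hseam : ∑ x, (2 - ((su2Rep (X.2 x * (Y.2 x)⁻¹)).trace).re) ≤ (L : ℝ) ^ 3 * ((2 : ℝ)⁻¹ * τ ^ 2) := by
    rw [← hcardS]
    have h := Finset.sum_le_card_nsmul (Finset.univ : Finset (Site 3 L)) (fun x => 2 - ((su2Rep (X.2 x * (Y.2 x)⁻¹)).trace).re)
      ((2 : ℝ)⁻¹ * τ ^ 2) (fun x _ => by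
        rw [two_sub_re_trace_eq_half_fd_sq]
        have := h2 x
        nlinarith [mul_le_mul this this (hfd0 _ _) hτ])
    rw [Finset.card_univ, nsmul_eq_mul] at h
    exact h
  have hslices : ∑ i, (6 * (L : ℝ) ^ 3 - timeCoupling su2Rep (X.1 i) (Y.1 i)) ≤ 2 * (L : ℝ) * (3 * (L : ℝ) ^ 3 * ((2 : ℝ)⁻¹ * τ ^ 2)) := by
    rw [← hcardI]
    have h := Finset.sum_le_card_nsmul (Finset.univ : Finset (Fin (2 * L - 1 + 1)))
      (fun i => 6 * (L : ℝ) ^ 3 - timeCoupling su2Rep (X.1 i) (Y.1 i)) _ (fun i _ => hslice i)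
    rw [Finset.card_univ, nsmul_eq_mul] at h
    exact h
  have hL34 : (L : ℝ) ^ 3 ≤ (L : ℝ) ^ 4 := pow_le_pow_right₀ hL1 (by norm_num)
  have hτ2 : 0 ≤ τ ^ 2 := sq_nonneg τ
  calc (∑ i, (6 * (L : ℝ) ^ 3 - timeCoupling su2Rep (X.1 i) (Y.1 i))) + ∑ x, (2 - ((su2Rep (X.2 x * (Y.2 x)⁻¹)).trace).re)
      ≤ 2 * (L : ℝ) * (3 * (L : ℝ) ^ 3 * ((2 : ℝ)⁻¹ * τ ^ 2)) + (L : ℝ) ^ 3 * ((2 : ℝ)⁻¹ * τ ^ 2) := add_le_add hslices hseam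
    _ = 3 * (L : ℝ) ^ 4 * τ ^ 2 + (2 : ℝ)⁻¹ * ((L : ℝ) ^ 3 * τ ^ 2) := by ring
    _ ≤ 3 * (L : ℝ) ^ 4 * τ ^ 2 + (2 : ℝ)⁻¹ * ((L : ℝ) ^ 4 * τ ^ 2) := by gcongr
    _ = 7 / 2 * (L : ℝ) ^ 4 * τ ^ 2 := by ring

omit [NeZero L] in
/-- Conjugating a comb-form flat configuration by a constant conjugates its wraps. [folklore] -/
theorem conj_combFlat_apply {w w' : Fin 3 → SU2} {c : SU2} (hc : ∀ k, w' k = c * w k * c⁻¹) (e : Edge 3 L) :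
    c * combFlat w e * c⁻¹ = combFlat w' e := by
  rw [combFlat_apply, combFlat_apply]
  split_ifs with hx
  · exact (hc e.2).symm
  · rw [mul_one, mul_inv_cancel]

/-- The squared `ℓ²` norm of chart data of sup-size `m` is at most `7L⁴m²` (`6L⁴ + L³` variables). [folklore] -/
theorem chart_sq_sum_le {m : ℝ} {A : Fin (2 * L - 1 + 1) → Edge 3 L → Matrix (Fin 2) (Fin 2) ℂ} {B : Site 3 L → Matrix (Fin 2) (Fin 2) ℂ}
    (hA : ∀ i e, ‖A i e‖ ≤ m) (hB : ∀ x, ‖B x‖ ≤ m) :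
    (∑ i : Fin (2 * L - 1 + 1), ∑ e : Edge 3 L, ‖A i e‖ ^ 2) + ∑ x : Site 3 L, ‖B x‖ ^ 2 ≤ 7 * (L : ℝ) ^ 4 * m ^ 2 := by
  have hL1 : (1 : ℝ) ≤ (L : ℝ) := by exact_mod_cast NeZero.one_le
  have hm0 : 0 ≤ m := (norm_nonneg _).trans (hB 0)
  have hcardE : (Fintype.card (Edge 3 L) : ℝ) = 3 * (L : ℝ) ^ 3 := by
    simp only [Edge, Site, Fintype.card_prod, Fintype.card_pi, Finset.prod_const, Finset.card_univ, Fintype.card_fin, ZMod.card]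
    push_cast; ring
  have hcardS : (Fintype.card (Site 3 L) : ℝ) = (L : ℝ) ^ 3 := by
    simp only [Site, Fintype.card_pi, Finset.prod_const, Finset.card_univ, Fintype.card_fin, ZMod.card]
    push_cast; ring
  have hcardI : (Fintype.card (Fin (2 * L - 1 + 1)) : ℝ) = 2 * (L : ℝ) := by
    have hL' : 2 * L - 1 + 1 = 2 * L := by have := NeZero.one_le (n := L); omega
    rw [Fintype.card_fin, hL']; push_cast; ring
  have h1 : ∀ i, ∑ e : Edge 3 L, ‖A i e‖ ^ 2 ≤ 3 * (L : ℝ) ^ 3 * m ^ 2 := by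
    intro i
    rw [← hcardE]
    have h := Finset.sum_le_card_nsmul (Finset.univ : Finset (Edge 3 L)) (fun e => ‖A i e‖ ^ 2) (m ^ 2)
      (fun e _ => pow_le_pow_left₀ (norm_nonneg _) (hA i e) 2)
    rw [Finset.card_univ, nsmul_eq_mul] at h
    exact h
  have h2 : ∑ i : Fin (2 * L - 1 + 1), ∑ e : Edge 3 L, ‖A i e‖ ^ 2 ≤ 2 * (L : ℝ) * (3 * (L : ℝ) ^ 3 * m ^ 2) := by
    rw [← hcardI]
    have h := Finset.sum_le_card_nsmul (Finset.univ : Finset (Fin (2 * L - 1 + 1))) (fun i => ∑ e : Edge 3 L, ‖A i e‖ ^ 2) _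
      (fun i _ => h1 i)
    rw [Finset.card_univ, nsmul_eq_mul] at h
    exact h
  have h3 : ∑ x : Site 3 L, ‖B x‖ ^ 2 ≤ (L : ℝ) ^ 3 * m ^ 2 := by
    rw [← hcardS]
    have h := Finset.sum_le_card_nsmul (Finset.univ : Finset (Site 3 L)) (fun x => ‖B x‖ ^ 2) (m ^ 2)
      (fun x _ => pow_le_pow_left₀ (norm_nonneg _) (hB x) 2)
    rw [Finset.card_univ, nsmul_eq_mul] at h
    exact h
  have hL34 : (L : ℝ) ^ 3 ≤ (L : ℝ) ^ 4 := pow_le_pow_right₀ hL1 (by norm_num)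
  nlinarith [mul_le_mul_of_nonneg_right hL34 (sq_nonneg m)]

/-- Far-class arithmetic: `1/(18L) ≤ (7/2)L⁴τ²` with `τ = (3/2)m + 176L²s`, `m ≤ 1/(32L³)` forces `m ≤ 176L²s`. [folklore] -/
theorem far_class_aux {x m τ sF : ℝ} (hx : 1 ≤ x) (hm : m ≤ 1 / (32 * x ^ 3)) (hsF : 0 ≤ sF)
    (hτ : τ = 3 / 2 * m + 176 * x ^ 2 * sF) (hlow : 1 / (18 * x) ≤ 7 / 2 * x ^ 4 * τ ^ 2) : m ≤ 176 * x ^ 2 * sF := by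
  by_contra hcon
  push Not at hcon
  have hx0 : 0 < x := by linarith
  have hm0 : 0 < m := by nlinarith [hsF, sq_nonneg x]
  have hτ0 : 0 ≤ τ := by rw [hτ]; positivity
  have hτm : τ < 5 / 2 * m := by rw [hτ]; linarith
  have hτ2 : τ ^ 2 < (5 / 2 * m) ^ 2 := by nlinarith
  have hm3 : m * x ^ 3 ≤ 1 / 32 := by
    rw [le_div_iff₀ (by positivity)] at hm; linarith
  have h1 : 7 / 2 * x ^ 4 * τ ^ 2 * x ^ 2 < 7 / 2 * x ^ 4 * (5 / 2 * m) ^ 2 * x ^ 2 := by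
    have : 0 < 7 / 2 * x ^ 4 * x ^ 2 := by positivity
    nlinarith
  have h2 : 7 / 2 * x ^ 4 * (5 / 2 * m) ^ 2 * x ^ 2 ≤ 175 / 8 * (1 / 32) ^ 2 := by
    have e : 7 / 2 * x ^ 4 * (5 / 2 * m) ^ 2 * x ^ 2 = 175 / 8 * (m * x ^ 3) ^ 2 := by ring
    rw [e]
    have := pow_le_pow_left₀ (by positivity) hm3 2
    nlinarith
  have h3 : 1 / 18 ≤ 1 / (18 * x) * x ^ 2 := by
    rw [div_mul_eq_mul_div, le_div_iff₀ (by positivity)]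
    nlinarith
  have h4 : 1 / (18 * x) * x ^ 2 ≤ 7 / 2 * x ^ 4 * τ ^ 2 * x ^ 2 := mul_le_mul_of_nonneg_right hlow (by positivity)
  linarith

/-- Far-class conclusion: `m ≤ 176L²√F` gives `7L⁴m² ≤ 220000·L⁸·F`. [folklore] -/
theorem far_class_aux' {x m sF F : ℝ} (hm0 : 0 ≤ m) (hsF2 : sF ^ 2 = F) (hmu : m ≤ 176 * x ^ 2 * sF) :
    7 * x ^ 4 * m ^ 2 ≤ 220000 * x ^ 8 * F := by
  have h1 : m ^ 2 ≤ (176 * x ^ 2 * sF) ^ 2 := pow_le_pow_left₀ hm0 hmu 2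
  rw [mul_pow, mul_pow, hsF2] at h1
  have hF0 : 0 ≤ F := by rw [← hsF2]; exact sq_nonneg _
  nlinarith [mul_le_mul_of_nonneg_left h1 (by positivity : (0 : ℝ) ≤ 7 * x ^ 4),
    mul_nonneg (by positivity : (0 : ℝ) ≤ x ^ 8) hF0]

end Summit.QuantumFields.YangMills.Theorems.VirialFluxGap.ChartPhase
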